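import Mathlib
import Summits.Schanuel.Schanuel.Theses.RigidCore
import Summits.Schanuel.Schanuel.Theorems.RigidCoreMinimalCounterexampleInAclLogSector
import Summits.Schanuel.Schanuel.Theorems.RigidCoreMinimalCounterexampleInAclAclCriterion
import Summits.Schanuel.Schanuel.Theorems.RigidCoreMinimalCounterexampleInAclResidues

/-!
# The rank split of (S*): crux stmt-Schanuel-0969 `RigidCore.MinimalCounterexampleInAcl` is its rank-2 slice AND item stmt-14744

Route `RigidCore`, line `kernel-arithmetic-selection` (lead prover-line-stmt-Schanuel-0969-c3-0), `--supports stmt-Schanuel-0969`.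

The crux (S*) says: every coordinate of a first-failure counterexample `x ∈ ℂⁿ` to Schanuel's conjecture
(`x ∈ firstFailures n`: `x` ℚ-linearly independent, `trdeg ℚ(x, eˣ) < n`, `SchanuelRank r` for all `r < n`) lies in
`acl^{ℂ_exp}(∅) = expAcl`.  Ranks `0, 1` carry no first failure (`two_le_of_mem_firstFailures`, Hermite–Lindemann), and
the route files the slice `3 ≤ n` as its own crux `MinimalCounterexampleInAclGeThree` (item stmt-Schanuel-14744).  This
file makes the resulting bookkeeping KERNEL-EXPLICIT, in the weakest known form of each piece:

* `minimalCounterexampleInAcl_iff_rankTwo_and_geThree`: (S*) ⟺ (S*)₂ ∧ `MinimalCounterexampleInAclGeThree`, where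
  (S*)₂ := `∀ x ∈ firstFailures 2, ∀ i, x i ∈ expAcl` is the verbatim rank-2 slice;
* `rankTwo_iff_offLog`: (S*)₂ ⟺ its OFF-LOG part (some `e^{x_i}` transcendental) — the log sector is the landed theorem
  `stub_cruxLogSector`;
* `rankTwo_iff_offLog_aclField`: (S*)₂ ⟺ for every off-log rank-2 first failure `x`, `acl(∅)` contains a TRANSCENDENTAL
  number algebraic over `ℚ(x, eˣ)` (the landed `acl`-field criterion `firstFailure_two_mem_expAcl_iff`);
* `rankTwo_of_sparsityTwo`: the sibling crux `SparsityTwo` (stmt-Schanuel-0971) implies (S*)₂ (landed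
  `locusMates_finite_of_sparsityTwo` + `rankTwo_crux_of_locusMates_finite`), hence
  `minimalCounterexampleInAcl_iff_geThree_of_sparsityTwo`: under `SparsityTwo`, (S*) ⟺ item 14744;
* `minimalCounterexampleInAcl_iff_residues`: (S*) ⟺ [off-log rank-2 `acl`-field statement] ∧ item 14744.

So the crux has NO content of its own beyond its two sibling items: at rank 2 it is implied by `SparsityTwo` (and is
possibly strictly weaker than the mate finiteness `SparsityTwo` is equivalent to, `sparsityTwo_iff_rankTwo_locusMates_finite`:
membership in `acl(∅)` may be witnessed by `∅`-definable finite sets other than projections of the mate set), and in ranks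
`≥ 3` it IS item 14744.

References: J. Kirby, *Exponential algebraicity in exponential fields*, arXiv:0810.4285, Prop. 7.2 (first failures lie
in `ecl(∅)`); Kirby–Macintyre–Onshuus, arXiv:1101.4224, §2 (`ℤ`, `2πi` are `∅`-definable/algebraic in `ℂ_exp`).
-/

noncomputable section

set_option linter.dupNamespace false

open Complex Set FirstOrder

namespace Summit.Schanuel.Schanuel.Cruxes.MinimalCounterexampleInAcl.KernelArithmeticSelection

open Literature.NumberTheory.Transcendental (SchanuelRank)
open Literature.ModelTheory.ExponentialFields
open Summit.Schanuel.Schanuel.Theorems.AclSubsetLogFreeCore.Negative (expAcl)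
open Summit.Schanuel.Schanuel.Theses.RigidCore (MinimalCounterexampleInAcl MinimalCounterexampleInAclGeThree SparsityTwo)

/-! ## (S*) = rank-2 slice ∧ ranks ≥ 3 -/

/-- The `3 ≤ n` slice (item stmt-Schanuel-14744) follows from the crux verbatim. [folklore] -/
theorem minimalCounterexampleInAclGeThree_of_minimalCounterexampleInAcl (h : MinimalCounterexampleInAcl) :
    MinimalCounterexampleInAclGeThree :=
  fun n _ x hx htr hSR i => h n x hx htr hSR i

/-- The rank-2 slice follows from the crux verbatim (`x i ∈ expAcl` is by definition the crux's conclusion). [folklore] -/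
theorem rankTwo_of_minimalCounterexampleInAcl (h : MinimalCounterexampleInAcl) :
    ∀ x : Fin 2 → ℂ, x ∈ firstFailures 2 → ∀ i, x i ∈ expAcl :=
  fun x hx i => h 2 x hx.1 hx.2.1 hx.2.2 i

/-- **(S*) from its rank-2 slice and item stmt-14744**: ranks `0, 1` carry no first failure (Hermite–Lindemann,
`two_le_of_mem_firstFailures`). [cite: Kirby2010, Prop. 7.2] -/
theorem minimalCounterexampleInAcl_of_rankTwo_of_geThree
    (h₂ : ∀ x : Fin 2 → ℂ, x ∈ firstFailures 2 → ∀ i, x i ∈ expAcl)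
    (h₃ : MinimalCounterexampleInAclGeThree) : MinimalCounterexampleInAcl := by
  intro n x hx htr hSR i
  have hff : x ∈ firstFailures n := ⟨hx, htr, hSR⟩
  rcases (two_le_of_mem_firstFailures hff).eq_or_lt with h | h
  · subst h
    exact h₂ x hff i
  · exact h₃ n h x hx htr hSR i

/-- **THE RANK SPLIT.** (S*) ⟺ (its verbatim rank-2 slice) ∧ `MinimalCounterexampleInAclGeThree` (item stmt-14744).
[cite: Kirby2010, Prop. 7.2] -/
theorem minimalCounterexampleInAcl_iff_rankTwo_and_geThree :
    MinimalCounterexampleInAcl ↔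
      (∀ x : Fin 2 → ℂ, x ∈ firstFailures 2 → ∀ i, x i ∈ expAcl) ∧ MinimalCounterexampleInAclGeThree :=
  ⟨fun h => ⟨rankTwo_of_minimalCounterexampleInAcl h, minimalCounterexampleInAclGeThree_of_minimalCounterexampleInAcl h⟩,
    fun h => minimalCounterexampleInAcl_of_rankTwo_of_geThree h.1 h.2⟩

/-! ## The rank-2 slice: only the off-log sector is open, and there it is an `acl`-field statement -/

/-- **The rank-2 slice ⟺ its off-log part.** On the LOG SECTOR (every `e^{x_i}` algebraic) the slice is the landed theorem
`stub_cruxLogSector` (Hermite–Lindemann + branch finiteness + definable isolation), so only first failures with SOME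
transcendental exponential remain. [cite: Kirby2010, Prop. 7.2] -/
theorem rankTwo_iff_offLog :
    (∀ x : Fin 2 → ℂ, x ∈ firstFailures 2 → ∀ i, x i ∈ expAcl) ↔
      ∀ x : Fin 2 → ℂ, x ∈ firstFailures 2 → (∃ i, Transcendental ℚ (cexp (x i))) → ∀ i, x i ∈ expAcl := by
  refine ⟨fun h x hx _ i => h x hx i, fun h x hx i => ?_⟩
  by_cases halg : ∀ j, IsAlgebraic ℚ (cexp (x j))
  · exact stub_cruxLogSector 2 x hx halg i
  · obtain ⟨j, hj⟩ := not_forall.mp halg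
    exact h x hx ⟨j, hj⟩ i

/-- **The rank-2 slice as an `acl`-FIELD statement**: (S*)₂ ⟺ for every off-log rank-2 first failure `x`, SOME
transcendental element of `acl(∅)` is algebraic over `ℚ(x, eˣ)` (landed criterion `firstFailure_two_mem_expAcl_iff`:
`acl(∅)` is a relatively algebraically closed subfield and `trdeg ℚ(x, eˣ) = 1`).  This is the weakest known form of the
crux's open content at the first open rank. [cite: KirbyMacintyreOnshuus2012, §2] -/
theorem rankTwo_iff_offLog_aclField :
    (∀ x : Fin 2 → ℂ, x ∈ firstFailures 2 → ∀ i, x i ∈ expAcl) ↔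
      ∀ x : Fin 2 → ℂ, x ∈ firstFailures 2 → (∃ i, Transcendental ℚ (cexp (x i))) →
        ∃ κ : ℂ, κ ∈ expAcl ∧ Transcendental ℚ κ ∧
          IsAlgebraic (IntermediateField.adjoin ℚ (range x ∪ range (cexp ∘ x))) κ := by
  rw [rankTwo_iff_offLog]
  refine ⟨fun h x hx hoff => ?_, fun h x hx hoff => ?_⟩
  · exact (firstFailure_two_mem_expAcl_iff hx).1 (h x hx hoff)
  · exact (firstFailure_two_mem_expAcl_iff hx).2 (h x hx hoff)

/-! ## The rank-2 slice is implied by the sibling crux `SparsityTwo` (stmt-Schanuel-0971) -/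

/-- **`SparsityTwo` ⟹ (S*)₂**: the mates of a rank-2 first failure are ℚ-independent exponential points of a `ℚ`-curve of
dimension `< 2` (landed `locusMates_finite_of_sparsityTwo`), and finiteness of the `∅`-definable mate set puts every
coordinate into `acl(∅)` (landed `rankTwo_crux_of_locusMates_finite`). [cite: Kirby2010, Prop. 7.2] -/
theorem rankTwo_of_sparsityTwo (hSp : SparsityTwo) :
    ∀ x : Fin 2 → ℂ, x ∈ firstFailures 2 → ∀ i, x i ∈ expAcl :=
  fun _ hx i => rankTwo_crux_of_locusMates_finite (fun _ h => locusMates_finite_of_sparsityTwo hSp h) hx i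

/-- **Under `SparsityTwo`, the crux (S*) IS item stmt-14744** (`MinimalCounterexampleInAclGeThree`). [cite: Kirby2010, Prop. 7.2] -/
theorem minimalCounterexampleInAcl_iff_geThree_of_sparsityTwo (hSp : SparsityTwo) :
    MinimalCounterexampleInAcl ↔ MinimalCounterexampleInAclGeThree :=
  ⟨minimalCounterexampleInAclGeThree_of_minimalCounterexampleInAcl,
    fun h₃ => minimalCounterexampleInAcl_of_rankTwo_of_geThree (rankTwo_of_sparsityTwo hSp) h₃⟩

/-! ## The residue theorem -/

/-- **THE RESIDUES OF (S*)**: the crux is EQUIVALENT to the conjunction of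
(i) the off-log rank-2 `acl`-field statement — for every rank-2 first failure `x` with some `e^{x_i}` transcendental,
`acl^{ℂ_exp}(∅)` meets the relative algebraic closure of `ℚ(x, eˣ)` outside `ℚ̄` — which is implied by the sibling crux
`SparsityTwo` (stmt-0971), and (ii) item stmt-14744 `MinimalCounterexampleInAclGeThree` verbatim.
[cite: Kirby2010, Prop. 7.2] [cite: KirbyMacintyreOnshuus2012, §2] -/
theorem minimalCounterexampleInAcl_iff_residues :
    MinimalCounterexampleInAcl ↔
      (∀ x : Fin 2 → ℂ, x ∈ firstFailures 2 → (∃ i, Transcendental ℚ (cexp (x i))) →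
          ∃ κ : ℂ, κ ∈ expAcl ∧ Transcendental ℚ κ ∧
            IsAlgebraic (IntermediateField.adjoin ℚ (range x ∪ range (cexp ∘ x))) κ) ∧
        MinimalCounterexampleInAclGeThree := by
  rw [minimalCounterexampleInAcl_iff_rankTwo_and_geThree, rankTwo_iff_offLog_aclField]

/-- The off-log rank-2 `acl`-field residue follows from `SparsityTwo`. [cite: Kirby2010, Prop. 7.2] -/
theorem rankTwo_offLog_aclField_of_sparsityTwo (hSp : SparsityTwo) :
    ∀ x : Fin 2 → ℂ, x ∈ firstFailures 2 → (∃ i, Transcendental ℚ (cexp (x i))) →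
      ∃ κ : ℂ, κ ∈ expAcl ∧ Transcendental ℚ κ ∧
        IsAlgebraic (IntermediateField.adjoin ℚ (range x ∪ range (cexp ∘ x))) κ :=
  rankTwo_iff_offLog_aclField.1 (rankTwo_of_sparsityTwo hSp)

/-! ## Registered form (explicit, fully inlined; `ledger workitem stub-add stmt-Schanuel-0969 --name crux_iff_residues …`) -/

/-- Registered form of `minimalCounterexampleInAcl_iff_residues` (stub `crux_iff_residues` of item stmt-Schanuel-0969):
**the crux (S*) is equivalent to the conjunction of its two residues** — the off-log rank-2 `acl`-field statement (implied by
the sibling crux `SparsityTwo`, stmt-0971) and item stmt-14744 `MinimalCounterexampleInAclGeThree` verbatim.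
[cite: Kirby2010, Prop. 7.2] [cite: KirbyMacintyreOnshuus2012, §2] -/
theorem crux_iff_residues : Summit.Schanuel.Schanuel.Theses.RigidCore.MinimalCounterexampleInAcl ↔ ((∀ x : Fin 2 → ℂ, x ∈ Summit.Schanuel.Schanuel.Cruxes.MinimalCounterexampleInAcl.KernelArithmeticSelection.firstFailures 2 → (∃ i, Transcendental ℚ (Complex.exp (x i))) → ∃ κ : ℂ, κ ∈ Summit.Schanuel.Schanuel.Theorems.AclSubsetLogFreeCore.Negative.expAcl ∧ Transcendental ℚ κ ∧ IsAlgebraic ↥(IntermediateField.adjoin ℚ (Set.range x ∪ Set.range (Complex.exp ∘ x))) κ) ∧ Summit.Schanuel.Schanuel.Theses.RigidCore.MinimalCounterexampleInAclGeThree) :=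
  minimalCounterexampleInAcl_iff_residues

end Summit.Schanuel.Schanuel.Cruxes.MinimalCounterexampleInAcl.KernelArithmeticSelection

end
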